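import Summits.QuantumFields.YangMills.Theorems.SwapVirialDeficitSectorLaplaceMbDensityDetFol
import Summits.QuantumFields.YangMills.Theorems.SwapVirialDeficitQuantitativeLaplaceQuadraticShift
import Summits.QuantumFields.YangMills.Theorems.SwapVirialDeficitBlowUpGnomonicFibreFloorForm
import Summits.QuantumFields.YangMills.Theorems.SwapVirialDeficitQuantitativeLaplaceGaussianPair
import Mathlib.Analysis.InnerProductSpace.Adjoint
import HarnessLib

/-!
# Route `SwapVirialDeficit` (YangMills): THE MORSE–BOTT DENSITY IS BOUNDED ABOVE BY THE FLOOR-FORM DETERMINANT — `𝔪(a,ε,p) ≤ ρ(η₀)∕(α_z^{3∕2}·det M·√det A_F(η₀))`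
# (cell ym-idea-1, skeleton ➎, `stub_core_tip`: the TIP SIDE `mbDensity_le_floorDet` of w2 g60's memo3 §6 Hessian sandwich;
# free-hands support of ⟨stmt-QuantumFields-24197⟩ `SwapVirialDeficit.SwapGluedStiffness`)

At a hub `a` (`re a ≠ 0`, `im a ≠ 0`), good signs `ε` and base point `p = (x₀, y₀)`, suppose the fibre quadratic form `Q = Q_{a,ε,p}` (✓`fibQ`) dominates a
STRUCTURED FLOOR in the leader letters only,
`Q(y) ≥ α_u|u|² + α_v|v|² + c_r((u₁y₀ − x₀v₁)² + (x₀v₀ − u₀y₀)²) + α_z|z|²` (`α_v, c_r ≥ 0`, `α_z > 0`, `det M := α_uα_v + c_r(α_u x₀² + α_v y₀²) > 0`)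
— e.g. w2 g60's ✓`fibQ_angUnit_ge_floorForm` at the hub `angUnit θ`.  Then the Morse–Bott density `𝔪 = ρ(η₀)(2π)^{−α}∫_{V_L}e^{−½Q}` satisfies
★★★ `mbDensity_le_of_floorForm` — `𝔪(a,ε,p) ≤ ρ(gnoBase p) ∕ (√α_z³ · det M · √det A_F(gnoBase p))` for every symmetric follower family `A_F` with the form identity
at the hub `a` (✓`exists_gnoFolHessian`); and at the tip hub `angUnit θ` (`cos θ ≠ 0`, `sin θ ≠ 0`)
★★ `mbDensity_angUnit_le_floorDet` — the same with memo3's coefficients `α_u = 4c²s²∕(7200L⁶(1+x₀²))`, `α_v = s²∕(1800L⁶(1+y₀²))`,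
`c_r = 1∕(1800L⁶(1+x₀²)(1+y₀²))`, `α_z = 1∕(4·1800L⁶)` (`det M ≍ s²` off the corner: ONE soft pair — the order memo3 §5 needs against the shell side).
Proof (memo3 §6 TIP SIDE): split `V_L` into the seven leader-transverse letters `ℓ = (u, v, z)` and the followers (✓`gnoFibreBlocksEquiv`, Tonelli); at fixed `ℓ` the
follower restriction `f ↦ Q(ℓ + f)` is a shifted quadratic with top form `A_F(η₀)` (✓`inner_gnoFibreHessian_fol`) whose minimum is `≥ floor(ℓ)` (followers do not
enter the floor), so w2 g60's ✓`integral_exp_neg_half_quadratic_le` gives `∫_f e^{−½Q(ℓ+f)} ≤ e^{−½floor(ℓ)}(2π)^{d∕2}∕√det A_F`; the remaining seven-letter Gaussian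
is EXACT: two COUPLED pairs `(u_j, v_j)` (`lintegral_exp_neg_half_pairForm`, completing the square: `2π∕√det M` each) and the `z`-block `(2π∕α_z)^{3∕2}`;
the powers of `2π` cancel against `(2π)^{−α}`, `2α = 7 + d` exactly.

HONEST LABEL: measure ∕ Gaussian plumbing at fixed `L`; the shell side `mbDensity_ge_softCeil`, the comparability, `stub_core_tip`, `stub_end_gaussCore`, ⟨24197⟩ ∕ ⟨24194⟩
OPEN; own crux ⟨22884⟩ `LargeFieldMassRefinementTail` OPEN (blocked-on ⟨19935⟩); the Yang–Mills mass gap is NOT proved; no summit is proved by a line.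
THEOREMS ONLY (0 `def`, 0 `sorry`, no instance), standard axioms.  Width seat ym-line-sfw-p2-w2 g61 (cell ym-idea-1, free hands), `--supports stmt-QuantumFields-24197`.
References: [cite: Breitung1994, Lemma 26]; [cite: Luscher1983, §2]; [folklore].
-/

set_option autoImplicit false
set_option synthInstance.maxSize 1024

noncomputable section

open MeasureTheory Quaternion Set Module
open scoped Quaternion BigOperators ENNReal InnerProductSpace
open Literature.MathematicalPhysics.QuantumLattice
open Literature.MathematicalPhysics.QuantumFieldTheory hiding SU2

namespace Summit.QuantumFields.YangMills.Theorems.SwapVirialDeficit.SectorLaplace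

open Summit.QuantumFields.YangMills.Theorems.FemtoTransferGap
open Summit.QuantumFields.YangMills.Theorems.FemtoTransferGap.TT
open Summit.QuantumFields.YangMills.Theorems.VirialFluxGap.RingDeficit
open Summit.QuantumFields.YangMills.Theorems.SwapVirialDeficit.SwapRing
open Summit.QuantumFields.YangMills.Theorems.SwapVirialDeficit.BlowUpRing
open Summit.QuantumFields.YangMills.Theorems.SwapVirialDeficit.Gnomonic (normSq3 normSq3_nonneg)
open Summit.QuantumFields.YangMills.Theorems.QuantitativeLaplace (integral_exp_neg_mul_half_inner integrable_exp_neg_mul_half_inner inner_pos_of_coercive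
  exists_quadratic_critical quadratic_complete_square integral_exp_neg_half_quadratic_le lintegral_exp_neg_half_pairForm)
open Literature.Analysis.Asymptotics (det_pos_of_inner_pos)

variable {L : ℕ} [NeZero L]

/-! ## §1 The seven-letter floor Gaussian -/

/-- ★ **THE SEVEN-LETTER FLOOR GAUSSIAN**: over `ℓ = ((u, v), z) ∈ ((Fin 2 → ℝ) × (Fin 2 → ℝ)) × (Fin 3 → ℝ)`,
`∫⁻ e^{−½(Σ_j (A u_j² − 2B u_j v_j + C v_j²) + α_z|z|²)} = (2π∕√(AC − B²))²·√(π∕(α_z∕2))³`. [folklore] -/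
theorem lintegral_exp_neg_half_floorBlocks {A B C αz : ℝ} (hC : 0 < C) (hD : 0 < A * C - B ^ 2) (hαz : 0 < αz) :
    ∫⁻ ℓ : ((Fin 2 → ℝ) × (Fin 2 → ℝ)) × (Fin 3 → ℝ),
        ENNReal.ofReal (Real.exp (-(1 / 2) * ((∑ j, (A * ℓ.1.1 j ^ 2 - 2 * B * ℓ.1.1 j * ℓ.1.2 j + C * ℓ.1.2 j ^ 2)) + αz * ∑ k, ℓ.2 k ^ 2))) =
      ENNReal.ofReal ((2 * Real.pi / Real.sqrt (A * C - B ^ 2)) ^ 2) * ENNReal.ofReal (Real.sqrt (Real.pi / (αz / 2)) ^ 3) := by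
  have e : ∀ ℓ : ((Fin 2 → ℝ) × (Fin 2 → ℝ)) × (Fin 3 → ℝ),
      ENNReal.ofReal (Real.exp (-(1 / 2) * ((∑ j, (A * ℓ.1.1 j ^ 2 - 2 * B * ℓ.1.1 j * ℓ.1.2 j + C * ℓ.1.2 j ^ 2)) + αz * ∑ k, ℓ.2 k ^ 2))) =
        ENNReal.ofReal (Real.exp (-(1 / 2) * ∑ j, (A * ℓ.1.1 j ^ 2 - 2 * B * ℓ.1.1 j * ℓ.1.2 j + C * ℓ.1.2 j ^ 2))) *
          ENNReal.ofReal (Real.exp (-(αz / 2 * ∑ k, ℓ.2 k ^ 2))) := fun ℓ => by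
    have hsplit : -(1 / 2) * ((∑ j, (A * ℓ.1.1 j ^ 2 - 2 * B * ℓ.1.1 j * ℓ.1.2 j + C * ℓ.1.2 j ^ 2)) + αz * ∑ k, ℓ.2 k ^ 2) =
        -(1 / 2) * (∑ j, (A * ℓ.1.1 j ^ 2 - 2 * B * ℓ.1.1 j * ℓ.1.2 j + C * ℓ.1.2 j ^ 2)) + -(αz / 2 * ∑ k, ℓ.2 k ^ 2) := by ring
    rw [hsplit, Real.exp_add, ENNReal.ofReal_mul (Real.exp_pos _).le]
  simp_rw [e]
  have hm1 : Measurable fun q : (Fin 2 → ℝ) × (Fin 2 → ℝ) => ENNReal.ofReal (Real.exp (-(1 / 2) * ∑ j, (A * q.1 j ^ 2 - 2 * B * q.1 j * q.2 j + C * q.2 j ^ 2))) := by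
    refine ENNReal.measurable_ofReal.comp (Real.measurable_exp.comp (Measurable.const_mul (Finset.measurable_sum _ fun j _ => ?_) _))
    have h1 : Measurable fun q : (Fin 2 → ℝ) × (Fin 2 → ℝ) => q.1 j := (measurable_pi_apply j).comp measurable_fst
    have h2 : Measurable fun q : (Fin 2 → ℝ) × (Fin 2 → ℝ) => q.2 j := (measurable_pi_apply j).comp measurable_snd
    exact (((h1.pow_const 2).const_mul A).sub (((h1.const_mul (2 * B)).mul h2))).add ((h2.pow_const 2).const_mul C)
  have hm2 : Measurable fun z : Fin 3 → ℝ => ENNReal.ofReal (Real.exp (-(αz / 2 * ∑ k, z k ^ 2))) :=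
    ENNReal.measurable_ofReal.comp (Real.measurable_exp.comp
      ((Finset.measurable_sum _ fun k _ => (measurable_pi_apply k).pow_const 2).const_mul _).neg)
  rw [MeasureTheory.Measure.volume_eq_prod, lintegral_prod_mul hm1.aemeasurable hm2.aemeasurable, lintegral_exp_neg_half_pairForm hC hD,
    ← ofReal_integral_eq_lintegral_ofReal (integrable_exp_neg_mul_sumSq_pi 3 (by positivity : 0 < αz / 2)) (ae_of_all _ fun z => (Real.exp_pos _).le),
    integral_exp_neg_mul_sumSq_pi 3 (αz / 2)]

/-! ## §2 The follower fibre at fixed leader letters: a shifted Gaussian, bounded by any floor of its minimum -/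

/-- ★★ **THE FOLLOWER FIBRE BOUND**: for the fibre Hessian family `A` (symmetric, form identity) and a symmetric `λ`-coercive follower family `A_F` with the form identity
(so that the follower block of `A(η)` is `A_F(η)`, ✓`inner_gnoFibreHessian_fol`), any `x ∈ V_L` and any floor `m ≤ ⟪A(η)(x + ι f), x + ι f⟫` (`ι = gnoFolToFibre`):
`∫⁻_f e^{−½⟪A(η)(x + ιf), x + ιf⟫} ≤ e^{−m∕2}·(2π)^{d∕2}∕√det A_F(η)` (completing the square over the followers, ✓`integral_exp_neg_half_quadratic_le`).
[cite: Breitung1994, Lemma 26] -/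
theorem lintegral_folFibre_le {a : ℍ} (ha : a ≠ 0) (ε : GnoSign L)
    {A : GnoCoord L → GnoFibre L →ₗ[ℝ] GnoFibre L} (hAs : ∀ η, (A η).IsSymmetric)
    (hAyy : ∀ η (y : GnoFibre L), ⟪A η y, y⟫_ℝ = iteratedFDeriv ℝ 2 (fun y' : GnoFibre L => gnoDeficit z₀ (fun _ => 1) a ε (η + gnoFibreEmb y')) 0 (fun _ => y))
    {AF : GnoCoord L → GnoFol L →ₗ[ℝ] GnoFol L} (hFs : ∀ η, (AF η).IsSymmetric)
    (hFyy : ∀ η (y : GnoFol L), ⟪AF η y, y⟫_ℝ = iteratedFDeriv ℝ 2 (fun y' : GnoFol L => gnoDeficit z₀ (fun _ => 1) a ε (η + gnoFolEmb y')) 0 (fun _ => y))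
    (η : GnoCoord L) {lam : ℝ} (hlam : 0 < lam) (hcoerF : ∀ f : GnoFol L, lam * ‖f‖ ^ 2 ≤ ⟪AF η f, f⟫_ℝ) (x : GnoFibre L) {m : ℝ}
    (hm : ∀ f : GnoFol L, m ≤ ⟪A η (x + gnoFolToFibre f), x + gnoFolToFibre f⟫_ℝ) :
    ∫⁻ f : GnoFol L, ENNReal.ofReal (Real.exp (-((1 / 2) * ⟪A η (x + gnoFolToFibre f), x + gnoFolToFibre f⟫_ℝ))) ≤
      ENNReal.ofReal (Real.exp (-(m / 2)) * ((2 * Real.pi) ^ ((finrank ℝ (GnoFol L) : ℝ) / 2) / Real.sqrt (LinearMap.det (AF η)))) := by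
  -- the shifted quadratic in the followers
  set b : GnoFol L := LinearMap.adjoint (gnoFolToFibre (L := L)).toLinearMap (A η x) with hb
  set c : ℝ := ⟪A η x, x⟫_ℝ with hc
  have hquad : ∀ f : GnoFol L, ⟪A η (x + gnoFolToFibre f), x + gnoFolToFibre f⟫_ℝ = ⟪AF η f, f⟫_ℝ + 2 * ⟪b, f⟫_ℝ + c := fun f => by
    have hfol := inner_gnoFibreHessian_fol z₀ (fun _ => 1) ha ε hAyy hFyy η f
    have hbf : ⟪b, f⟫_ℝ = ⟪A η x, gnoFolToFibre f⟫_ℝ := by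
      rw [hb, LinearMap.adjoint_inner_left]; rfl
    have hsym : ⟪A η (gnoFolToFibre f), x⟫_ℝ = ⟪A η x, gnoFolToFibre f⟫_ℝ := by rw [hAs η _ x, real_inner_comm]
    rw [map_add, inner_add_left, inner_add_right, inner_add_right, hfol, hsym, hbf, hc]
    ring
  simp_rw [hquad]
  have hm' : ∀ f : GnoFol L, m ≤ ⟪AF η f, f⟫_ℝ + 2 * ⟪b, f⟫_ℝ + c := fun f => by rw [← hquad]; exact hm f
  -- integrability of the shifted Gaussian (complete the square, translate)
  obtain ⟨fs, hfs⟩ := exists_quadratic_critical hlam hcoerF b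
  have hint : Integrable fun f : GnoFol L => Real.exp (-((1 / 2) * (⟪AF η f, f⟫_ℝ + 2 * ⟪b, f⟫_ℝ + c))) := by
    have e : (fun f : GnoFol L => Real.exp (-((1 / 2) * (⟪AF η f, f⟫_ℝ + 2 * ⟪b, f⟫_ℝ + c)))) =
        fun f => Real.exp (-((1 / 2) * (c - ⟪AF η fs, fs⟫_ℝ))) * (fun g : GnoFol L => Real.exp (-(1 * ((1 / 2) * ⟪AF η g, g⟫_ℝ)))) (f - fs) := by
      funext f
      rw [quadratic_complete_square (hFs η) hfs c f, ← Real.exp_add]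
      congr 1; ring
    rw [e]
    exact ((integrable_exp_neg_mul_half_inner hlam hcoerF one_pos).comp_sub_right fs).const_mul _
  rw [← ofReal_integral_eq_lintegral_ofReal hint (ae_of_all _ fun f => (Real.exp_pos _).le)]
  exact ENNReal.ofReal_le_ofReal (integral_exp_neg_half_quadratic_le (hFs η) hlam hcoerF b c hm')

/-! ## §3 Block plumbing: Tonelli over leader-transverse letters and followers; the letters of a block vector -/

/-- ★ **TONELLI IN BLOCK LETTERS**: `∫⁻_{V_L} G = ∫⁻_ℓ ∫⁻_F G(E⁻¹(ℓ.1, (ℓ.2, F)))` with `E = gnoFibreBlocksEquiv` (volume preserving), `ℓ = ((u,v), z)`. [folklore] -/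
theorem lintegral_gnoFibre_eq_blocks (G : GnoFibre L → ℝ≥0∞) (hG : Measurable G) :
    ∫⁻ y : GnoFibre L, G y = ∫⁻ ℓ : ((Fin 2 → ℝ) × (Fin 2 → ℝ)) × (Fin 3 → ℝ), ∫⁻ F : Fol L → Fin 3 → ℝ,
      G ((gnoFibreBlocksEquiv (L := L)).symm (ℓ.1, (ℓ.2, F))) := by
  set E : GnoFibre L ≃ᵐ ((Fin 2 → ℝ) × (Fin 2 → ℝ)) × (Fin 3 → ℝ) × (Fol L → Fin 3 → ℝ) := gnoFibreBlocksEquiv (L := L) with hE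
  have h1 : ∫⁻ y : GnoFibre L, G y = ∫⁻ b, G (E.symm b) ∂(volume : Measure (((Fin 2 → ℝ) × (Fin 2 → ℝ)) × (Fin 3 → ℝ) × (Fol L → Fin 3 → ℝ))) := by
    rw [← (volume_preserving_gnoFibreBlocksEquiv (L := L)).symm.lintegral_comp_emb E.symm.measurableEmbedding]
  have h2 : (volume : Measure (((Fin 2 → ℝ) × (Fin 2 → ℝ)) × (Fin 3 → ℝ) × (Fol L → Fin 3 → ℝ))) =
      Measure.map MeasurableEquiv.prodAssoc (((volume : Measure ((Fin 2 → ℝ) × (Fin 2 → ℝ))).prod (volume : Measure (Fin 3 → ℝ))).prod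
        (volume : Measure (Fol L → Fin 3 → ℝ))) := by
    rw [Measure.prodAssoc_prod]; rfl
  have hG' : Measurable fun b : ((Fin 2 → ℝ) × (Fin 2 → ℝ)) × (Fin 3 → ℝ) × (Fol L → Fin 3 → ℝ) => G (E.symm b) := hG.comp E.symm.measurable
  rw [h1, h2, lintegral_map hG' MeasurableEquiv.prodAssoc.measurable]
  have hG'' : Measurable fun q : (((Fin 2 → ℝ) × (Fin 2 → ℝ)) × (Fin 3 → ℝ)) × (Fol L → Fin 3 → ℝ) => G (E.symm (MeasurableEquiv.prodAssoc q)) :=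
    hG'.comp MeasurableEquiv.prodAssoc.measurable
  rw [lintegral_prod _ hG''.aemeasurable, ← MeasureTheory.Measure.volume_eq_prod]
  refine lintegral_congr fun ℓ => lintegral_congr fun F => ?_
  simp only [MeasurableEquiv.prodAssoc, MeasurableEquiv.coe_mk, Equiv.prodAssoc_apply]

omit [NeZero L] in
/-- The leader letters of a block vector: for `y = E⁻¹(ℓ.1, (ℓ.2, F))`, `u_j = ℓ.1.1 j`, `v_j = ℓ.1.2 j`, `z_k = ℓ.2 k`. [folklore] -/
theorem gnoFibreBlocksEquiv_symm_letters (ℓ : ((Fin 2 → ℝ) × (Fin 2 → ℝ)) × (Fin 3 → ℝ)) (F : Fol L → Fin 3 → ℝ) :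
    (∀ j, ((gnoFibreBlocksEquiv (L := L)).symm (ℓ.1, (ℓ.2, F))) (Sum.inl (Sum.inl j)) = ℓ.1.1 j) ∧
    (∀ j, ((gnoFibreBlocksEquiv (L := L)).symm (ℓ.1, (ℓ.2, F))) (Sum.inl (Sum.inr j)) = ℓ.1.2 j) ∧
    (∀ k, ((gnoFibreBlocksEquiv (L := L)).symm (ℓ.1, (ℓ.2, F))) (Sum.inr (Sum.inl k)) = ℓ.2 k) := by
  have hb : gnoFibreBlocks ((gnoFibreBlocksEquiv (L := L)).symm (ℓ.1, (ℓ.2, F))) = (ℓ.1, (ℓ.2, F)) := by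
    rw [← gnoFibreBlocksEquiv_apply]; exact (gnoFibreBlocksEquiv (L := L)).apply_symm_apply _
  refine ⟨fun j => ?_, fun j => ?_, fun k => ?_⟩
  · exact congrFun (congrArg (fun w => w.1.1) hb) j
  · exact congrFun (congrArg (fun w => w.1.2) hb) j
  · exact congrFun (congrArg (fun w => w.2.1) hb) k

/-! ## §4 The upper bound -/

set_option maxHeartbeats 1600000 in
/-- ★★★ **THE MORSE–BOTT DENSITY IS BOUNDED ABOVE BY THE FLOOR-FORM DETERMINANT.**  Hub `a` with `re a ≠ 0`, `im a ≠ 0`, good signs, base point `p = (x₀,y₀)`;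
`A_F` a symmetric follower family with the form identity at the hub `a`; a structured floor of `Q_{a,ε,p}` in the leader letters with `α_v, c_r ≥ 0`, `α_z > 0`,
`det M = α_uα_v + c_r(α_u x₀² + α_v y₀²) > 0`.  Then `𝔪(a,ε,p) ≤ ρ(gnoBase p)∕(√α_z³·det M·√det A_F(gnoBase p))`. [cite: Breitung1994, Lemma 26] [cite: Luscher1983, §2] -/
theorem mbDensity_le_of_floorForm {a : ℍ} (hre : a.re ≠ 0) (him : a.im ≠ 0) {ε : GnoSign L} (hε : GoodSign ε) (p : ℝ × ℝ)
    {AF : GnoCoord L → GnoFol L →ₗ[ℝ] GnoFol L} (hFs : ∀ η, (AF η).IsSymmetric)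
    (hFyy : ∀ η (y : GnoFol L), ⟪AF η y, y⟫_ℝ = iteratedFDeriv ℝ 2 (fun y' : GnoFol L => gnoDeficit z₀ (fun _ => 1) a ε (η + gnoFolEmb y')) 0 (fun _ => y))
    {αu αv cr αz : ℝ} (hαv : 0 ≤ αv) (hcr : 0 ≤ cr) (hαz : 0 < αz) (hdet : 0 < αu * αv + cr * (αu * p.1 ^ 2 + αv * p.2 ^ 2))
    (hfloor : ∀ y : GnoFibre L, αu * (y (Sum.inl (Sum.inl 0)) ^ 2 + y (Sum.inl (Sum.inl 1)) ^ 2) + αv * (y (Sum.inl (Sum.inr 0)) ^ 2 + y (Sum.inl (Sum.inr 1)) ^ 2) +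
        cr * ((y (Sum.inl (Sum.inl 1)) * p.2 - p.1 * y (Sum.inl (Sum.inr 1))) ^ 2 + (p.1 * y (Sum.inl (Sum.inr 0)) - y (Sum.inl (Sum.inl 0)) * p.2) ^ 2) +
        αz * (∑ k, y (Sum.inr (Sum.inl k)) ^ 2) ≤ fibQ a ε p y) :
    mbDensity (L := L) a ε p ≤ gnoDensity (gnoBase p.1 p.2 : GnoCoord L) /
      (Real.sqrt αz ^ 3 * (αu * αv + cr * (αu * p.1 ^ 2 + αv * p.2 ^ 2)) * Real.sqrt (LinearMap.det (AF (gnoBase p.1 p.2)))) := by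
  have ha : a ≠ 0 := fun h => hre (by rw [h]; rfl)
  have hL : (0 : ℝ) < (L : ℝ) := Nat.cast_pos.2 (Nat.pos_of_ne_zero (NeZero.ne L))
  set η₀ : GnoCoord L := gnoBase p.1 p.2 with hη₀
  set detM : ℝ := αu * αv + cr * (αu * p.1 ^ 2 + αv * p.2 ^ 2) with hdetM
  -- dimensions (opaque)
  have hd9 := nine_le_finrank_gnoFol (L := L)
  obtain ⟨d, hd⟩ : ∃ d : ℝ, (finrank ℝ (GnoFol L) : ℝ) = d := ⟨_, rfl⟩
  rw [hd] at hd9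
  have hdpos : 0 < d := by linarith
  have hdn : (finrank ℝ (GnoFol L) : ℝ) = 3 * (Fintype.card (Fol L) : ℝ) := finrank_gnoFol_real (L := L)
  have hdimL : (finrank ℝ (GnoFibre L) : ℝ) = 7 + d := by
    rw [← hd, hdn]
    have h := card_gnoFibreIdx (L := L)
    rw [finrank_euclideanSpace, h]; push_cast; ring
  -- the fibre Hessian at η₀ and the quadratic form
  obtain ⟨A, hAs, -, hAyy, hAray, hAm, hAbd, -⟩ := exists_gnoFibreHessian z₀ (fun _ => 1) ha ε
  have hQ : ∀ y : GnoFibre L, fibQ a ε p y = ⟪A η₀ y, y⟫_ℝ := fun y => (hAray η₀ y).symm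
  -- coercivity of the follower block
  set lam : ℝ := min (min (2 * (2 * (‖a‖⁻¹ * a.re) * (‖a‖⁻¹ * ‖a.im‖)) ^ 2 / ((2 + p.1 ^ 2) * (16200 * (L : ℝ) ^ 6)))
        (2 * (‖a‖⁻¹ * ‖a.im‖) ^ 2 / ((2 + p.2 ^ 2) * (16200 * (L : ℝ) ^ 6))))
      (min (1 / (16200 * (L : ℝ) ^ 6)) ((2304 * (L : ℝ) ^ 6 * (Fintype.card (Fol L) : ℝ))⁻¹ / 2)) with hlam
  have hlampos : 0 < lam := lam_explicit_pos hre him p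
  have hcoerA : ∀ y : GnoFibre L, lam * ‖y‖ ^ 2 ≤ ⟪A η₀ y, y⟫_ℝ := fun y => by rw [← hQ]; exact fibQ_coercive_explicit hre him hε p y
  have hfol : ∀ f : GnoFol L, ⟪A η₀ (gnoFolToFibre f), gnoFolToFibre f⟫_ℝ = ⟪AF η₀ f, f⟫_ℝ := fun f =>
    inner_gnoFibreHessian_fol z₀ (fun _ => 1) ha ε hAyy hFyy η₀ f
  have hcoerF : ∀ f : GnoFol L, lam * ‖f‖ ^ 2 ≤ ⟪AF η₀ f, f⟫_ℝ := fun f => by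
    rw [← hfol, ← norm_gnoFolToFibre f]; exact hcoerA _
  have hdetF : 0 < LinearMap.det (AF η₀) := det_pos_of_inner_pos (hFs η₀) (inner_pos_of_coercive hlampos hcoerF)
  -- the block maps
  set E : GnoFibre L ≃ᵐ ((Fin 2 → ℝ) × (Fin 2 → ℝ)) × (Fin 3 → ℝ) × (Fol L → Fin 3 → ℝ) := gnoFibreBlocksEquiv (L := L) with hE
  set ι₁ : ((Fin 2 → ℝ) × (Fin 2 → ℝ)) × (Fin 3 → ℝ) → GnoFibre L := fun ℓ => E.symm (ℓ.1, (ℓ.2, (0 : Fol L → Fin 3 → ℝ))) with hι₁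
  set ι₂ : (Fol L → Fin 3 → ℝ) → GnoFibre L := fun F => E.symm (((0 : Fin 2 → ℝ), (0 : Fin 2 → ℝ)), ((0 : Fin 3 → ℝ), F)) with hι₂
  have hEadd : ∀ y y' : GnoFibre L, E (y + y') = E y + E y' := fun y y' => by
    show gnoFibreBlocks (y + y') = gnoFibreBlocks y + gnoFibreBlocks y'
    rfl
  have hdecomp : ∀ (ℓ : ((Fin 2 → ℝ) × (Fin 2 → ℝ)) × (Fin 3 → ℝ)) (F : Fol L → Fin 3 → ℝ), E.symm (ℓ.1, (ℓ.2, F)) = ι₁ ℓ + ι₂ F := fun ℓ F => by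
    apply E.injective
    rw [hEadd, hι₁, hι₂, E.apply_symm_apply, E.apply_symm_apply, E.apply_symm_apply]
    simp
  have hι₂fol : ∀ f : GnoFol L, ι₂ (gnoFolBlocksEquiv f) = gnoFolToFibre f := fun f => by
    rw [hι₂]
    apply E.injective
    rw [E.apply_symm_apply, hE, gnoFibreBlocksEquiv_apply, gnoFibreBlocks_gnoFolToFibre, gnoFolBlocksEquiv_apply]
  -- the completed-square letters of the floor
  set Aq : ℝ := αu + cr * p.2 ^ 2 with hAq
  set Bq : ℝ := cr * p.1 * p.2 with hBq
  set Cq : ℝ := αv + cr * p.1 ^ 2 with hCq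
  have hDq : Aq * Cq - Bq ^ 2 = detM := by rw [hAq, hBq, hCq, hdetM]; ring
  have hCqpos : 0 < Cq := by
    rcases hαv.lt_or_eq with hv | hv
    · rw [hCq]; positivity
    · -- `αv = 0`: then `det M = cr·αu·x₀² > 0` forces `cr > 0`, `x₀ ≠ 0`
      rw [hCq, ← hv, zero_add]
      rw [hdetM, ← hv] at hdet
      have h1 : 0 < cr * (αu * p.1 ^ 2) := by nlinarith
      have hcr' : 0 < cr := by
        rcases hcr.lt_or_eq with h | h
        · exact h
        · rw [← h, zero_mul] at h1; exact absurd h1 (lt_irrefl 0)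
      have hx : 0 < p.1 ^ 2 := by
        rcases (sq_nonneg p.1).lt_or_eq with h | h
        · exact h
        · rw [← h, mul_zero, mul_zero] at h1; exact absurd h1 (lt_irrefl 0)
      positivity
  have hDqpos : 0 < Aq * Cq - Bq ^ 2 := by rw [hDq]; exact hdet
  -- the floor at fixed leader letters, in completed-square form
  set mℓ : (((Fin 2 → ℝ) × (Fin 2 → ℝ)) × (Fin 3 → ℝ)) → ℝ := fun ℓ =>
    (∑ j, (Aq * ℓ.1.1 j ^ 2 - 2 * Bq * ℓ.1.1 j * ℓ.1.2 j + Cq * ℓ.1.2 j ^ 2)) + αz * ∑ k, ℓ.2 k ^ 2 with hmℓ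
  have hfloorℓ : ∀ (ℓ : ((Fin 2 → ℝ) × (Fin 2 → ℝ)) × (Fin 3 → ℝ)) (f : GnoFol L), mℓ ℓ ≤ ⟪A η₀ (ι₁ ℓ + gnoFolToFibre f), ι₁ ℓ + gnoFolToFibre f⟫_ℝ := by
    intro ℓ f
    rw [← hQ, ← hι₂fol, ← hdecomp ℓ (gnoFolBlocksEquiv f)]
    obtain ⟨hu, hv, hz⟩ := gnoFibreBlocksEquiv_symm_letters (L := L) ℓ (gnoFolBlocksEquiv f)
    have h := hfloor (E.symm (ℓ.1, (ℓ.2, gnoFolBlocksEquiv f)))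
    rw [hE] at h ⊢
    rw [hu 0, hu 1, hv 0, hv 1] at h
    simp only [hz] at h
    refine le_trans (le_of_eq ?_) h
    simp only [hmℓ, Fin.sum_univ_two, hAq, hBq, hCq]
    ring
  -- §A the fibre integral in block letters
  have hint := integrable_exp_neg_fibQ_half hre him hε p
  have hIeq : ENNReal.ofReal (∫ y : GnoFibre L, Real.exp (-(fibQ a ε p y / 2))) =
      ∫⁻ ℓ : ((Fin 2 → ℝ) × (Fin 2 → ℝ)) × (Fin 3 → ℝ), ∫⁻ F : Fol L → Fin 3 → ℝ,
        ENNReal.ofReal (Real.exp (-((1 / 2) * ⟪A η₀ (ι₁ ℓ + ι₂ F), ι₁ ℓ + ι₂ F⟫_ℝ))) := by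
    have hGm : Measurable fun y : GnoFibre L => ENNReal.ofReal (Real.exp (-(fibQ a ε p y / 2))) :=
      ENNReal.measurable_ofReal.comp (Real.measurable_exp.comp ((measurable_fibQ ha ε p).div_const 2).neg)
    rw [ofReal_integral_eq_lintegral_ofReal hint (ae_of_all _ fun y => (Real.exp_pos _).le), lintegral_gnoFibre_eq_blocks _ hGm]
    refine lintegral_congr fun ℓ => lintegral_congr fun F => ?_
    rw [← hE, hdecomp ℓ F, hQ]; ring_nf
  -- §B the follower fibre at fixed ℓ
  have hfib : ∀ ℓ : ((Fin 2 → ℝ) × (Fin 2 → ℝ)) × (Fin 3 → ℝ),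
      ∫⁻ F : Fol L → Fin 3 → ℝ, ENNReal.ofReal (Real.exp (-((1 / 2) * ⟪A η₀ (ι₁ ℓ + ι₂ F), ι₁ ℓ + ι₂ F⟫_ℝ))) ≤
        ENNReal.ofReal (Real.exp (-(mℓ ℓ / 2)) * ((2 * Real.pi) ^ (d / 2) / Real.sqrt (LinearMap.det (AF η₀)))) := fun ℓ => by
    have hmeasF : Measurable fun F : Fol L → Fin 3 → ℝ => ENNReal.ofReal (Real.exp (-((1 / 2) * ⟪A η₀ (ι₁ ℓ + ι₂ F), ι₁ ℓ + ι₂ F⟫_ℝ))) := by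
      have hFι : Measurable fun F : Fol L → Fin 3 → ℝ => (ℓ.1, (ℓ.2, F)) := measurable_const.prodMk (measurable_const.prodMk measurable_id)
      have hy : Measurable fun F : Fol L → Fin 3 → ℝ => E.symm (ℓ.1, (ℓ.2, F)) := E.symm.measurable.comp hFι
      have hq : Measurable fun F : Fol L → Fin 3 → ℝ => fibQ a ε p (E.symm (ℓ.1, (ℓ.2, F))) := (measurable_fibQ ha ε p).comp hy
      have e : (fun F : Fol L → Fin 3 → ℝ => ENNReal.ofReal (Real.exp (-((1 / 2) * ⟪A η₀ (ι₁ ℓ + ι₂ F), ι₁ ℓ + ι₂ F⟫_ℝ)))) =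
          fun F => ENNReal.ofReal (Real.exp (-((1 / 2) * fibQ a ε p (E.symm (ℓ.1, (ℓ.2, F)))))) := by
        funext F; rw [hQ, hdecomp ℓ F]
      rw [e]
      exact ENNReal.measurable_ofReal.comp (Real.measurable_exp.comp (hq.const_mul _).neg)
    rw [← (volume_preserving_gnoFolBlocksEquiv (L := L)).lintegral_comp hmeasF, ← hd]
    calc ∫⁻ f : GnoFol L, ENNReal.ofReal (Real.exp (-((1 / 2) * ⟪A η₀ (ι₁ ℓ + ι₂ (gnoFolBlocksEquiv f)), ι₁ ℓ + ι₂ (gnoFolBlocksEquiv f)⟫_ℝ)))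
        = ∫⁻ f : GnoFol L, ENNReal.ofReal (Real.exp (-((1 / 2) * ⟪A η₀ (ι₁ ℓ + gnoFolToFibre f), ι₁ ℓ + gnoFolToFibre f⟫_ℝ))) :=
          lintegral_congr fun f => by rw [hι₂fol]
      _ ≤ _ := lintegral_folFibre_le ha ε hAs hAyy hFs hFyy η₀ hlampos hcoerF (ι₁ ℓ) (hfloorℓ ℓ)
  -- §C the seven-letter Gaussian
  have hKF : 0 < (2 * Real.pi) ^ (d / 2) / Real.sqrt (LinearMap.det (AF η₀)) := by positivity
  have hmℓmeas : Measurable fun ℓ : ((Fin 2 → ℝ) × (Fin 2 → ℝ)) × (Fin 3 → ℝ) => ENNReal.ofReal (Real.exp (-(mℓ ℓ / 2))) := by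
    refine ENNReal.measurable_ofReal.comp (Real.measurable_exp.comp (Measurable.neg (Measurable.div_const ?_ _)))
    rw [hmℓ]
    refine (Finset.measurable_sum _ fun j _ => ?_).add ((Finset.measurable_sum _ fun k _ => ((measurable_pi_apply k).comp measurable_snd).pow_const 2).const_mul _)
    have h1 : Measurable fun q : ((Fin 2 → ℝ) × (Fin 2 → ℝ)) × (Fin 3 → ℝ) => q.1.1 j := (measurable_pi_apply j).comp (measurable_fst.comp measurable_fst)
    have h2 : Measurable fun q : ((Fin 2 → ℝ) × (Fin 2 → ℝ)) × (Fin 3 → ℝ) => q.1.2 j := (measurable_pi_apply j).comp (measurable_snd.comp measurable_fst)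
    exact (((h1.pow_const 2).const_mul Aq).sub (((h1.const_mul (2 * Bq)).mul h2))).add ((h2.pow_const 2).const_mul Cq)
  have hseven : ∫⁻ ℓ : ((Fin 2 → ℝ) × (Fin 2 → ℝ)) × (Fin 3 → ℝ), ENNReal.ofReal (Real.exp (-(mℓ ℓ / 2))) =
      ENNReal.ofReal ((2 * Real.pi / Real.sqrt (Aq * Cq - Bq ^ 2)) ^ 2) * ENNReal.ofReal (Real.sqrt (Real.pi / (αz / 2)) ^ 3) := by
    rw [← lintegral_exp_neg_half_floorBlocks hCqpos hDqpos hαz]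
    refine lintegral_congr fun ℓ => ?_
    simp only [hmℓ]
    congr 2
    ring
  -- §D the chain in `ℝ≥0∞`
  have hchain : ENNReal.ofReal (∫ y : GnoFibre L, Real.exp (-(fibQ a ε p y / 2))) ≤
      ENNReal.ofReal ((2 * Real.pi / Real.sqrt (Aq * Cq - Bq ^ 2)) ^ 2) * ENNReal.ofReal (Real.sqrt (Real.pi / (αz / 2)) ^ 3) *
        ENNReal.ofReal ((2 * Real.pi) ^ (d / 2) / Real.sqrt (LinearMap.det (AF η₀))) := by
    rw [hIeq]
    calc ∫⁻ ℓ : ((Fin 2 → ℝ) × (Fin 2 → ℝ)) × (Fin 3 → ℝ), ∫⁻ F : Fol L → Fin 3 → ℝ,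
          ENNReal.ofReal (Real.exp (-((1 / 2) * ⟪A η₀ (ι₁ ℓ + ι₂ F), ι₁ ℓ + ι₂ F⟫_ℝ)))
        ≤ ∫⁻ ℓ : ((Fin 2 → ℝ) × (Fin 2 → ℝ)) × (Fin 3 → ℝ), ENNReal.ofReal (Real.exp (-(mℓ ℓ / 2))) *
            ENNReal.ofReal ((2 * Real.pi) ^ (d / 2) / Real.sqrt (LinearMap.det (AF η₀))) := by
          refine lintegral_mono fun ℓ => ?_
          rw [← ENNReal.ofReal_mul (Real.exp_pos _).le]
          exact hfib ℓ
      _ = (∫⁻ ℓ : ((Fin 2 → ℝ) × (Fin 2 → ℝ)) × (Fin 3 → ℝ), ENNReal.ofReal (Real.exp (-(mℓ ℓ / 2)))) *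
            ENNReal.ofReal ((2 * Real.pi) ^ (d / 2) / Real.sqrt (LinearMap.det (AF η₀))) := lintegral_mul_const _ hmℓmeas
      _ = _ := by rw [hseven]
  -- back to `ℝ`
  have hIpos : 0 ≤ ∫ y : GnoFibre L, Real.exp (-(fibQ a ε p y / 2)) := integral_nonneg fun y => (Real.exp_pos _).le
  rw [← ENNReal.ofReal_mul (by positivity), ← ENNReal.ofReal_mul (by positivity)] at hchain
  have hreal := (ENNReal.ofReal_le_ofReal_iff (by positivity)).1 hchain
  rw [hDq] at hreal
  -- the normalisation `(2π)^{−α}`, `α = (7 + d)/2`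
  have hρ : 0 ≤ gnoDensity (gnoBase p.1 p.2 : GnoCoord L) := (gnoDensity_pos _).le
  have h2pipos : 0 < (2 * Real.pi) ^ ((7 + d) / 2) := by positivity
  rw [div_eq_mul_inv]
  unfold mbDensity alpha
  rw [hdimL, mul_assoc]
  refine mul_le_mul_of_nonneg_left ?_ hρ
  refine le_trans (mul_le_mul_of_nonneg_left hreal (by positivity)) (le_of_eq ?_)
  -- the powers of `2π` cancel: `(2π)^{(7+d)/2} = √(2π)^7·(2π)^{d/2}`, `(2π)² = √(2π)^4`, `√(π/(αz/2)) = √(2π)/√αz`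
  set S : ℝ := Real.sqrt (2 * Real.pi) with hS
  have hSpos : 0 < S := by rw [hS]; positivity
  have hS2 : 2 * Real.pi = S ^ 2 := by rw [hS, Real.sq_sqrt (by positivity)]
  have hS7 : (2 * Real.pi) ^ ((7 + d) / 2) = S ^ 7 * (2 * Real.pi) ^ (d / 2) := by
    rw [show (7 + d) / 2 = (7 : ℝ) / 2 + d / 2 by ring, Real.rpow_add (by positivity)]
    congr 1
    rw [hS, Real.sqrt_eq_rpow, ← Real.rpow_natCast, ← Real.rpow_mul (by positivity)]
    norm_num
  have hZ : Real.sqrt (Real.pi / (αz / 2)) = S / Real.sqrt αz := by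
    rw [hS, ← Real.sqrt_div (by positivity)]
    congr 1; field_simp
  have hsqαz : 0 < Real.sqrt αz := Real.sqrt_pos.2 hαz
  have hsqdet : 0 < Real.sqrt (LinearMap.det (AF η₀)) := Real.sqrt_pos.2 hdetF
  have hsqM : Real.sqrt detM ^ 2 = detM := Real.sq_sqrt hdet.le
  have hsqMpos : 0 < Real.sqrt detM := Real.sqrt_pos.2 hdet
  have hX : 0 < (2 * Real.pi) ^ (d / 2) := by positivity
  have h4 : (2 * Real.pi) ^ 2 = S ^ 4 := by rw [hS2]; ring
  have hSne : S ≠ 0 := hSpos.ne'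
  have hXne : (2 * Real.pi) ^ (d / 2) ≠ 0 := hX.ne'
  have hαne : Real.sqrt αz ≠ 0 := hsqαz.ne'
  have hdne : Real.sqrt (LinearMap.det (AF η₀)) ≠ 0 := hsqdet.ne'
  have hMne : detM ≠ 0 := hdet.ne'
  rw [hS7, hZ, div_pow, div_pow, hsqM, h4]
  field_simp

/-! ## §5 At the tip hub `angUnit θ`: memo3's structured floor -/

/-- The hub `angUnit θ` has `re = cos θ` and nonzero imaginary part iff `sin θ ≠ 0`. [folklore] -/
theorem angUnit_im_ne_zero {θ : ℝ} (hs : Real.sin θ ≠ 0) : (angUnit θ).im ≠ 0 := fun h => by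
  have h1 : (angUnit θ).im.imI = Real.sin θ := rfl
  rw [h] at h1
  exact hs (by rw [← h1]; rfl)

/-- ★★ **THE TIP-SIDE CEILING `mbDensity_le_floorDet`** (memo3 §6): at the hub `angUnit θ` (`cos θ ≠ 0`, `sin θ ≠ 0`), good signs, base point `p`, and any symmetric
follower family `A_F` with the form identity at `angUnit θ`,
`𝔪(angUnit θ, ε, p) ≤ ρ(gnoBase p) ∕ (√α_z³ · (α_uα_v + c_r(α_u x₀² + α_v y₀²)) · √det A_F(gnoBase p))` with
`α_u = ¼·16c²s²∕(7200L⁶(1+x₀²))`, `α_v = ¼·4s²∕(1800L⁶(1+y₀²))`, `c_r = ¼·4∕(1800L⁶(1+x₀²)(1+y₀²))`, `α_z = ¼·1∕(1800L⁶)` (✓`fibQ_angUnit_ge_floorForm`).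
[cite: Luscher1983, §2] [cite: Breitung1994, Lemma 26] -/
theorem mbDensity_angUnit_le_floorDet {θ : ℝ} (hc : Real.cos θ ≠ 0) (hs : Real.sin θ ≠ 0) {ε : GnoSign L} (hε : GoodSign ε) (p : ℝ × ℝ)
    {AF : GnoCoord L → GnoFol L →ₗ[ℝ] GnoFol L} (hFs : ∀ η, (AF η).IsSymmetric)
    (hFyy : ∀ η (y : GnoFol L), ⟪AF η y, y⟫_ℝ = iteratedFDeriv ℝ 2 (fun y' : GnoFol L => gnoDeficit z₀ (fun _ => 1) (angUnit θ) ε (η + gnoFolEmb y')) 0 (fun _ => y)) :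
    mbDensity (L := L) (angUnit θ) ε p ≤ gnoDensity (gnoBase p.1 p.2 : GnoCoord L) /
      (Real.sqrt ((1 / 4 : ℝ) * (1 / (1800 * (L : ℝ) ^ 6))) ^ 3 *
        (((1 / 4 : ℝ) * (16 * Real.cos θ ^ 2 * Real.sin θ ^ 2 / ((7200 * (L : ℝ) ^ 6) * (1 + p.1 ^ 2)))) * ((1 / 4 : ℝ) * (4 * Real.sin θ ^ 2 / ((1800 * (L : ℝ) ^ 6) * (1 + p.2 ^ 2)))) +
          ((1 / 4 : ℝ) * (4 / ((1800 * (L : ℝ) ^ 6) * ((1 + p.1 ^ 2) * (1 + p.2 ^ 2))))) *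
            (((1 / 4 : ℝ) * (16 * Real.cos θ ^ 2 * Real.sin θ ^ 2 / ((7200 * (L : ℝ) ^ 6) * (1 + p.1 ^ 2)))) * p.1 ^ 2 +
              ((1 / 4 : ℝ) * (4 * Real.sin θ ^ 2 / ((1800 * (L : ℝ) ^ 6) * (1 + p.2 ^ 2)))) * p.2 ^ 2)) *
        Real.sqrt (LinearMap.det (AF (gnoBase p.1 p.2)))) := by
  have hL : (0 : ℝ) < (L : ℝ) := Nat.cast_pos.2 (Nat.pos_of_ne_zero (NeZero.ne L))
  have hre : (angUnit θ).re ≠ 0 := by rw [angUnit_re]; exact hc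
  have him : (angUnit θ).im ≠ 0 := angUnit_im_ne_zero hs
  have hαv : 0 < (1 / 4 : ℝ) * (4 * Real.sin θ ^ 2 / ((1800 * (L : ℝ) ^ 6) * (1 + p.2 ^ 2))) := by positivity
  have hcr : 0 ≤ (1 / 4 : ℝ) * (4 / ((1800 * (L : ℝ) ^ 6) * ((1 + p.1 ^ 2) * (1 + p.2 ^ 2)))) := by positivity
  have hαz : 0 < (1 / 4 : ℝ) * (1 / (1800 * (L : ℝ) ^ 6)) := by positivity
  refine mbDensity_le_of_floorForm hre him hε p hFs hFyy hαv.le hcr hαz (by positivity) fun y => ?_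
  have h := fibQ_angUnit_ge_floorForm θ ε hε.1 hε.2 p y
  refine le_trans (le_of_eq ?_) h
  ring

end Summit.QuantumFields.YangMills.Theorems.SwapVirialDeficit.SectorLaplace

end
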